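import Literature.NumberTheory.Automorphic.IwasawaHaarGL2
import HarnessLib

/-!
# Thickening the mean-square regions of `GL₂(𝔸_K)`

Topic `NumberTheory/Automorphic`; namespace `Literature.NumberTheory.Automorphic`. A brick of the
mean-square route to Jacquet–Shalika's Theorem (5.3) for `GL₂`
(`StandardLFunctionData.multipliable_L`; files `IwasawaHaarGL2`, `InvariantMeasureDominationExplicit`,
`WhittakerBesselGL2`, `IdelicDyadicUnfolding`). The domination lemma with its explicit constant
(`measure_inter_invOrbitPreimage_le_mul`: `∫_D |φ|² ≤ ν(closure (B' D)) / μ(U) · ‖φ‖²`) is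
applied to the regions `D_X = N_c · d(z(r) Y₁, C₂) · K ⊆ GL₂(𝔸_K)` (`iwasawaRegionGL2`), dilated
by the archimedean scalar idele `z(r) = posRealIdele K r`, `r^{[K:ℚ]} = X⁻¹ → 0`; one needs the
*left* thickening `B' D_X` to be contained in a region of the same shape with the *same* dilation,
so that its Haar measure is still `O(X)`. This file proves exactly that:

* `exists_nhds_one_forall_conj_mem` — conjugation by a compact set is uniformly continuous at `1`
  (generalised tube lemma);
* `bigCellShift`, `bigCellFlat` — the big cell `N · B⁻` at the archimedean places near `1`:
  `w = n(x_w) w♭` with `(w♭₀₁)_∞ = 0` for `w` in the open set `archUnitSetGL2` (`(w₁₁)_∞`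
  invertible), continuously in `w`;
* `boxGL2`, `isCompact_boxGL2` — entry boxes (compact, via the closed embedding `g ↦ (g, g⁻¹)`);
  `starHull` — archimedean star hulls `{(t z_∞, z_f)}`;
  `diagGL2_inv_mul_mul_diagGL2_mem_boxGL2` — **contraction**: conjugating a flat factor by
  `d(z(r), 1)⁻¹`, `r ≤ 1`, stays in a fixed compact box (the lower entry is multiplied by `r`, the
  upper archimedean entry vanishes, the finite components of `z(r)` are `1`);
* `torusImageGL2`, `iwasawaRegionGL2`, `isCompact_iwasawaRegionGL2` — the regions;
  `exists_compact_borel_coords` — Borel coordinates of a compact set through `G = B K`;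
  `exists_compact_torusConj_mem` — torus conjugates `d(z(r) t₁, t₂) n₀ d(z(r) t₁, t₂)⁻¹` of a
  compact unipotent set stay in a compact set for `r ≤ 1`;
* `exists_thickening_iwasawaRegionGL2_subset` — **for compact `N_c, Y₁, C₂` there are `B' ∈ 𝓝 1`
  and compact `N'', Y₁', C₂'` with `B' · (N_c · d(z(r) Y₁, C₂) · K) ⊆ N'' · d(z(r) Y₁', C₂') · K`
  for all `r ≤ 1`.**

Everything is proved; folklore (the geometry of Siegel-type regions under left perturbation;
cf. Garrett, *Modern Analysis of Automorphic Forms by Example* (2018), §1.5 and Claim 7.3.6, and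
Getz–Hahn (2024), Lemma 9.5.1, for the analogous conjugation estimates on Siegel sets).

## References

* P. Garrett, *Modern Analysis of Automorphic Forms by Example* (2018), §1.5, §7.3 [Garrett2018].
* J. R. Getz, H. Hahn, *An Introduction to Automorphic Representations*, GTM 300 (2024), §9.5
  [GetzHahn2024].
-/

noncomputable section

open MeasureTheory Measure NumberField IsDedekindDomain Matrix Set Filter
open scoped MatrixGroups ENNReal NNReal Pointwise Topology

namespace Literature.NumberTheory.Automorphic

/-! ### Uniformly small conjugates over a compact set -/

section Conj

variable {G : Type*} [Group G] [TopologicalSpace G] [IsTopologicalGroup G]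

/-- **Conjugation by a compact set is uniformly continuous at `1`**: for compact `C ⊆ G` and a
neighbourhood `W` of `1` there is a neighbourhood `V` of `1` with `c⁻¹ v c ∈ W` for all `c ∈ C`,
`v ∈ V` (generalised tube lemma for `(c, v) ↦ c⁻¹ v c` at `C × {1}`). [folklore] -/
theorem exists_nhds_one_forall_conj_mem {C : Set G} (hC : IsCompact C) {W : Set G} (hW : W ∈ 𝓝 (1 : G)) :
    ∃ V ∈ 𝓝 (1 : G), ∀ c ∈ C, ∀ v ∈ V, c⁻¹ * v * c ∈ W := by
  set n : Set (G × G) := (fun p : G × G => p.1⁻¹ * p.2 * p.1) ⁻¹' interior W with hn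
  have hno : IsOpen n :=
    isOpen_interior.preimage ((continuous_fst.inv.mul continuous_snd).mul continuous_fst)
  have hsub : C ×ˢ ({1} : Set G) ⊆ n := by
    rintro ⟨c, v⟩ ⟨-, hv⟩
    rw [mem_singleton_iff] at hv
    subst hv
    change c⁻¹ * 1 * c ∈ interior W
    rw [mul_one, inv_mul_cancel]
    exact mem_interior_iff_mem_nhds.2 hW
  obtain ⟨u, v, -, hvo, hCu, h1v, huv⟩ := generalized_tube_lemma hC isCompact_singleton hno hsub
  refine ⟨v, hvo.mem_nhds (h1v (mem_singleton 1)), fun c hc x hx => ?_⟩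
  have : (c, x) ∈ n := huv (mk_mem_prod (hCu hc) hx)
  exact interior_subset this

end Conj

/-! ### Archimedean inverses -/

section Arch

variable (K : Type) [Field K]

/-- The coordinatewise inverse on `K_∞ = ∏_{w ∣ ∞} K_w` (total: `0⁻¹ = 0`). [folklore] -/
def archInv (y : InfiniteAdeleRing K) : InfiniteAdeleRing K := fun w => (y w)⁻¹

variable {K}

/-- `y · archInv y = 1` when all components of `y` are non-zero. [folklore] -/
theorem mul_archInv_eq_one {y : InfiniteAdeleRing K} (hy : ∀ w, y w ≠ 0) : y * archInv K y = 1 := by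
  funext w
  change y w * (y w)⁻¹ = 1
  exact mul_inv_cancel₀ (hy w)

/-- `archInv` is continuous at points with non-zero components. [folklore] -/
theorem continuousAt_archInv {y : InfiniteAdeleRing K} (hy : ∀ w, y w ≠ 0) : ContinuousAt (archInv K) y := by
  refine continuousAt_pi.2 fun w => ?_
  change ContinuousAt (fun z : InfiniteAdeleRing K => (z w)⁻¹) y
  exact ((continuous_apply w).continuousAt).inv₀ (hy w)

/-- The set of `y ∈ K_∞` with all components non-zero is open. [folklore] -/
theorem isOpen_setOf_forall_apply_ne_zero [NumberField K] : IsOpen {y : InfiniteAdeleRing K | ∀ w, y w ≠ 0} := by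
  have : {y : InfiniteAdeleRing K | ∀ w, y w ≠ 0} = ⋂ w, (fun y : InfiniteAdeleRing K => y w) ⁻¹' {0}ᶜ := by
    ext y; simp
  rw [this]
  exact isOpen_iInter_of_finite fun w => isOpen_compl_singleton.preimage (continuous_apply w)

end Arch

/-! ### The big cell near `1` at the archimedean places -/

section BigCell

variable (K : Type) [Field K] [NumberField K]

/-- The open set of `g ∈ GL₂(𝔸_K)` whose entry `g₁₁` has invertible archimedean components.
[folklore] -/
def archUnitSetGL2 : Set (GL (Fin 2) (AdeleRing (𝓞 K) K)) :=
  {g | ∀ w : InfinitePlace K, (((g : Matrix (Fin 2) (Fin 2) (AdeleRing (𝓞 K) K)) 1 1).1) w ≠ 0}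

/-- Continuity of the archimedean part of an entry. [folklore] -/
theorem continuous_entry_fst (i j : Fin 2) :
    Continuous fun g : GL (Fin 2) (AdeleRing (𝓞 K) K) => (((g : Matrix (Fin 2) (Fin 2) (AdeleRing (𝓞 K) K)) i j).1) :=
  continuous_fst.comp (Units.continuous_val.matrix_elem i j)

/-- `archUnitSetGL2` is open. [folklore] -/
theorem isOpen_archUnitSetGL2 : IsOpen (archUnitSetGL2 K) :=
  isOpen_setOf_forall_apply_ne_zero.preimage (continuous_entry_fst K 1 1)

/-- `1 ∈ archUnitSetGL2`. [folklore] -/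
theorem one_mem_archUnitSetGL2 : (1 : GL (Fin 2) (AdeleRing (𝓞 K) K)) ∈ archUnitSetGL2 K := by
  intro w
  rw [Units.val_one, Matrix.one_apply_eq]
  exact one_ne_zero

/-- **The big-cell shift** `x(g) = (g₀₁ g₁₁⁻¹ at the archimedean places, 0 at the finite places)`.
[folklore] -/
def bigCellShift (g : GL (Fin 2) (AdeleRing (𝓞 K) K)) : AdeleRing (𝓞 K) K :=
  (((g : Matrix (Fin 2) (Fin 2) (AdeleRing (𝓞 K) K)) 0 1).1 *
      archInv K (((g : Matrix (Fin 2) (Fin 2) (AdeleRing (𝓞 K) K)) 1 1).1), 0)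

/-- **The big-cell remainder** `g♭ = n(-x(g)) g`, whose entry `g♭₀₁` has vanishing archimedean
part (the `B⁻ N`-factorisation of `GL₂(K_∞)` near `1`). [folklore] -/
def bigCellFlat (g : GL (Fin 2) (AdeleRing (𝓞 K) K)) : GL (Fin 2) (AdeleRing (𝓞 K) K) :=
  ((unipotentGL2 (-bigCellShift K g) : ↥(adelicUnipotent 2 K)) : GL (Fin 2) (AdeleRing (𝓞 K) K)) * g

variable {K}

/-- `g = n(x(g)) · g♭`. [folklore] -/
theorem unipotentGL2_bigCellShift_mul_bigCellFlat (g : GL (Fin 2) (AdeleRing (𝓞 K) K)) :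
    ((unipotentGL2 (bigCellShift K g) : ↥(adelicUnipotent 2 K)) : GL (Fin 2) (AdeleRing (𝓞 K) K)) *
      bigCellFlat K g = g := by
  rw [bigCellFlat, ← mul_assoc, ← Subgroup.coe_mul, ← unipotentGL2_add, add_neg_cancel, unipotentGL2_zero,
    Subgroup.coe_one, one_mul]

/-- Entries of `n(y) g`: row `0` is `g₀ⱼ + y g₁ⱼ`, row `1` is `g₁ⱼ`. [folklore] -/
theorem unipotentGL2_mul_apply (y : AdeleRing (𝓞 K) K) (g : GL (Fin 2) (AdeleRing (𝓞 K) K)) (j : Fin 2) :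
    ((((unipotentGL2 y : ↥(adelicUnipotent 2 K)) : GL (Fin 2) (AdeleRing (𝓞 K) K)) * g :
        GL (Fin 2) (AdeleRing (𝓞 K) K)) : Matrix (Fin 2) (Fin 2) (AdeleRing (𝓞 K) K)) 0 j =
      (g : Matrix (Fin 2) (Fin 2) (AdeleRing (𝓞 K) K)) 0 j + y * (g : Matrix (Fin 2) (Fin 2) (AdeleRing (𝓞 K) K)) 1 j ∧
    ((((unipotentGL2 y : ↥(adelicUnipotent 2 K)) : GL (Fin 2) (AdeleRing (𝓞 K) K)) * g :
        GL (Fin 2) (AdeleRing (𝓞 K) K)) : Matrix (Fin 2) (Fin 2) (AdeleRing (𝓞 K) K)) 1 j =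
      (g : Matrix (Fin 2) (Fin 2) (AdeleRing (𝓞 K) K)) 1 j := by
  rw [Units.val_mul, coe_unipotentGL2]
  constructor
  · rw [Matrix.mul_apply, Fin.sum_univ_two]; simp
  · rw [Matrix.mul_apply, Fin.sum_univ_two]; simp

/-- **`(g♭₀₁)_∞ = 0`** for `g ∈ archUnitSetGL2`. [folklore] -/
theorem bigCellFlat_apply_zero_one_fst {g : GL (Fin 2) (AdeleRing (𝓞 K) K)} (hg : g ∈ archUnitSetGL2 K) :
    (((bigCellFlat K g : GL (Fin 2) (AdeleRing (𝓞 K) K)) : Matrix (Fin 2) (Fin 2) (AdeleRing (𝓞 K) K)) 0 1).1 = 0 := by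
  rw [bigCellFlat, (unipotentGL2_mul_apply _ g 1).1]
  change ((g : Matrix (Fin 2) (Fin 2) (AdeleRing (𝓞 K) K)) 0 1).1 +
    -(((g : Matrix (Fin 2) (Fin 2) (AdeleRing (𝓞 K) K)) 0 1).1 *
      archInv K (((g : Matrix (Fin 2) (Fin 2) (AdeleRing (𝓞 K) K)) 1 1).1)) *
      ((g : Matrix (Fin 2) (Fin 2) (AdeleRing (𝓞 K) K)) 1 1).1 = 0
  rw [neg_mul, mul_assoc, mul_comm (archInv K _), mul_archInv_eq_one hg, mul_one, add_neg_cancel]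

/-- For a `2 × 2` invertible adelic matrix `h` with `(h₀₁)_∞ = 0`, also `((h⁻¹)₀₁)_∞ = 0`
(`h⁻¹ = det⁻¹ adj h`, `(adj h)₀₁ = -h₀₁`). [folklore] -/
theorem inv_apply_zero_one_fst_eq_zero {h : GL (Fin 2) (AdeleRing (𝓞 K) K)}
    (hh : (((h : GL (Fin 2) (AdeleRing (𝓞 K) K)) : Matrix (Fin 2) (Fin 2) (AdeleRing (𝓞 K) K)) 0 1).1 = 0) :
    ((((h⁻¹ : GL (Fin 2) (AdeleRing (𝓞 K) K)) : Matrix (Fin 2) (Fin 2) (AdeleRing (𝓞 K) K)) 0 1).1) = 0 := by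
  rw [Matrix.coe_units_inv, Matrix.inv_def, Matrix.smul_apply, Matrix.adjugate_fin_two]
  simp only [Matrix.of_apply, Matrix.cons_val', Matrix.cons_val_zero, Matrix.cons_val_one, Matrix.cons_val_fin_one,
    smul_eq_mul]
  change (Ring.inverse ((h : Matrix (Fin 2) (Fin 2) (AdeleRing (𝓞 K) K)).det)).1 *
    (-((h : Matrix (Fin 2) (Fin 2) (AdeleRing (𝓞 K) K)) 0 1)).1 = 0
  have : (-((h : Matrix (Fin 2) (Fin 2) (AdeleRing (𝓞 K) K)) 0 1)).1 =
      -(((h : Matrix (Fin 2) (Fin 2) (AdeleRing (𝓞 K) K)) 0 1).1) := rfl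
  rw [this, hh, neg_zero, mul_zero]

/-- `bigCellShift` is continuous on `archUnitSetGL2`. [folklore] -/
theorem continuousOn_bigCellShift : ContinuousOn (bigCellShift K) (archUnitSetGL2 K) := by
  refine continuousOn_of_forall_continuousAt fun g hg => ?_
  refine ContinuousAt.prodMk ?_ continuousAt_const
  exact ((continuous_entry_fst K 0 1).continuousAt).mul
    ((continuousAt_archInv hg).comp_of_eq (continuous_entry_fst K 1 1).continuousAt rfl)

/-- `bigCellFlat` is continuous on `archUnitSetGL2`. [folklore] -/
theorem continuousOn_bigCellFlat : ContinuousOn (bigCellFlat K) (archUnitSetGL2 K) :=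
  ((continuous_subtype_val.comp continuous_unipotentGL2).comp_continuousOn
    (continuousOn_bigCellShift.neg)).mul continuousOn_id

end BigCell

/-! ### Entry boxes and archimedean star hulls -/

section Boxes

variable (K : Type) [Field K] [NumberField K]

/-- The **entry box** over `Z ⊆ 𝔸_K`: matrices `g ∈ GL₂(𝔸_K)` all of whose entries and whose
inverse's entries lie in `Z`. [folklore] -/
def boxGL2 (Z : Set (AdeleRing (𝓞 K) K)) : Set (GL (Fin 2) (AdeleRing (𝓞 K) K)) :=
  {g | ∀ i j : Fin 2, (g : Matrix (Fin 2) (Fin 2) (AdeleRing (𝓞 K) K)) i j ∈ Z ∧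
    (((g⁻¹ : GL (Fin 2) (AdeleRing (𝓞 K) K)) : Matrix (Fin 2) (Fin 2) (AdeleRing (𝓞 K) K)) i j ∈ Z)}

variable {K}

/-- **Entry boxes over compact sets are compact** (the units topology is the closed embedding
`g ↦ (g, g⁻¹)` into `M₂(𝔸_K) × M₂(𝔸_K)ᵐᵒᵖ`). [folklore] -/
theorem isCompact_boxGL2 {Z : Set (AdeleRing (𝓞 K) K)} (hZ : IsCompact Z) : IsCompact (boxGL2 K Z) := by
  haveI : T2Space (AdeleRing (𝓞 K) K) := t2Space_adeleRing K
  set S : Set (Matrix (Fin 2) (Fin 2) (AdeleRing (𝓞 K) K)) := univ.pi fun _ => univ.pi fun _ => Z with hS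
  have hSc : IsCompact S := isCompact_univ_pi fun _ => isCompact_univ_pi fun _ => hZ
  have hemb := (Units.isClosedEmbedding_embedProduct (α := Matrix (Fin 2) (Fin 2) (AdeleRing (𝓞 K) K)))
  have heq : boxGL2 K Z = Units.embedProduct _ ⁻¹' (S ×ˢ (MulOpposite.op '' S)) := by
    ext g
    rw [mem_preimage, Units.embedProduct_apply, mem_prod]
    constructor
    · intro h
      refine ⟨mem_univ_pi.2 fun i => mem_univ_pi.2 fun j => (h i j).1,
        ⟨(((g⁻¹ : GL (Fin 2) (AdeleRing (𝓞 K) K)) : Matrix (Fin 2) (Fin 2) (AdeleRing (𝓞 K) K))),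
          mem_univ_pi.2 fun i => mem_univ_pi.2 fun j => (h i j).2, rfl⟩⟩
    · rintro ⟨h1, M, hM, hMeq⟩ i j
      have hM' : M = (((g⁻¹ : GL (Fin 2) (AdeleRing (𝓞 K) K)) : Matrix (Fin 2) (Fin 2) (AdeleRing (𝓞 K) K))) :=
        MulOpposite.op_injective hMeq
      subst hM'
      exact ⟨mem_univ_pi.1 (mem_univ_pi.1 h1 i) j, mem_univ_pi.1 (mem_univ_pi.1 hM i) j⟩
  rw [heq]
  exact hemb.isCompact_preimage (hSc.prod (hSc.image MulOpposite.continuous_op))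

variable (K)

/-- The **archimedean star hull** of `Z ⊆ 𝔸_K`: `{(t z_∞, z_f) | t ∈ [0,1], z ∈ Z}`. [folklore] -/
def starHull (Z : Set (AdeleRing (𝓞 K) K)) : Set (AdeleRing (𝓞 K) K) :=
  (fun p : ℝ × AdeleRing (𝓞 K) K => ((realToInfiniteAdele K p.1 * p.2.1, p.2.2) : AdeleRing (𝓞 K) K)) ''
    (Icc (0 : ℝ) 1 ×ˢ Z)

variable {K}

/-- The defining map of the star hull is continuous. [folklore] -/
theorem continuous_starHullMap :
    Continuous fun p : ℝ × AdeleRing (𝓞 K) K => ((realToInfiniteAdele K p.1 * p.2.1, p.2.2) : AdeleRing (𝓞 K) K) :=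
  (((continuous_realToInfiniteAdele K).comp continuous_fst).mul (continuous_fst.comp continuous_snd)).prodMk
    (continuous_snd.comp continuous_snd)

/-- Star hulls of compact sets are compact. [folklore] -/
theorem isCompact_starHull {Z : Set (AdeleRing (𝓞 K) K)} (hZ : IsCompact Z) : IsCompact (starHull K Z) :=
  (isCompact_Icc.prod hZ).image continuous_starHullMap

/-- `Z ⊆ starHull Z`. [folklore] -/
theorem subset_starHull (Z : Set (AdeleRing (𝓞 K) K)) : Z ⊆ starHull K Z := by
  intro z hz
  refine ⟨(1, z), mk_mem_prod ⟨zero_le_one, le_rfl⟩ hz, ?_⟩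
  change ((realToInfiniteAdele K 1 * z.1, z.2) : AdeleRing (𝓞 K) K) = z
  rw [map_one, one_mul]
  rfl

/-- Multiples `z(r) · z`, `r ≤ 1`, of points of `Z` lie in its star hull. [folklore] -/
theorem posRealIdele_mul_mem_starHull {Z : Set (AdeleRing (𝓞 K) K)} {z : AdeleRing (𝓞 K) K} (hz : z ∈ Z)
    {r : ℝ≥0ˣ} (hr : (r : ℝ≥0) ≤ 1) :
    ((posRealIdele K r : (AdeleRing (𝓞 K) K)ˣ) : AdeleRing (𝓞 K) K) * z ∈ starHull K Z := by
  refine ⟨(((r : ℝ≥0) : ℝ), z), mk_mem_prod ⟨(r : ℝ≥0).2, by exact_mod_cast hr⟩ hz, ?_⟩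
  change ((realToInfiniteAdele K ((r : ℝ≥0) : ℝ) * z.1, z.2) : AdeleRing (𝓞 K) K) = _
  refine Prod.ext ?_ ?_
  · change realToInfiniteAdele K ((r : ℝ≥0) : ℝ) * z.1 =
      ((posRealIdele K r : (AdeleRing (𝓞 K) K)ˣ) : AdeleRing (𝓞 K) K).1 * z.1
    rw [posRealIdele_fst]
  · change z.2 = ((posRealIdele K r : (AdeleRing (𝓞 K) K)ˣ) : AdeleRing (𝓞 K) K).2 * z.2
    rw [posRealIdele_snd, one_mul]

/-- A point of `Z` with vanishing archimedean part lies in the star hull after any archimedean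
rescaling: `(y_∞ · 0, z_f) = (0, z_f) ∈ starHull Z`. [folklore] -/
theorem mul_mem_starHull_of_fst_eq_zero {Z : Set (AdeleRing (𝓞 K) K)} {z : AdeleRing (𝓞 K) K} (hz : z ∈ Z)
    (hz0 : z.1 = 0) {y : AdeleRing (𝓞 K) K} (hy : y.2 = 1) : y * z ∈ starHull K Z := by
  refine ⟨(0, z), mk_mem_prod ⟨le_rfl, zero_le_one⟩ hz, ?_⟩
  change ((realToInfiniteAdele K 0 * z.1, z.2) : AdeleRing (𝓞 K) K) = _
  refine Prod.ext ?_ ?_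
  · change realToInfiniteAdele K 0 * z.1 = y.1 * z.1
    rw [hz0, mul_zero, mul_zero]
  · change z.2 = y.2 * z.2
    rw [hy, one_mul]

/-- The matrix of `d(a,b)⁻¹ g d(c,d')`: entries `aᵢ⁻¹ gᵢⱼ cⱼ`. [folklore] -/
theorem coe_diagGL2_inv_mul_mul_diagGL2 {R : Type*} [CommRing R] (a b c d : Rˣ) (g : GL (Fin 2) R) :
    (((diagGL2 a b)⁻¹ * g * diagGL2 c d : GL (Fin 2) R) : Matrix (Fin 2) (Fin 2) R) =
      !![((a⁻¹ : Rˣ) : R) * (g : Matrix (Fin 2) (Fin 2) R) 0 0 * c, ((a⁻¹ : Rˣ) : R) * (g : Matrix (Fin 2) (Fin 2) R) 0 1 * d;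
         ((b⁻¹ : Rˣ) : R) * (g : Matrix (Fin 2) (Fin 2) R) 1 0 * c, ((b⁻¹ : Rˣ) : R) * (g : Matrix (Fin 2) (Fin 2) R) 1 1 * d] := by
  rw [diagGL2_inv, Units.val_mul, Units.val_mul, coe_diagGL2, coe_diagGL2]
  ext i j
  rw [Matrix.mul_apply, Fin.sum_univ_two, Matrix.mul_apply, Matrix.mul_apply, Fin.sum_univ_two, Fin.sum_univ_two]
  fin_cases i <;> fin_cases j <;> simp

/-- Entries of `d(ρ, 1)⁻¹ g d(ρ, 1)`: `g₀₀`, `ρ⁻¹ g₀₁`, `ρ g₁₀`, `g₁₁`. [folklore] -/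
theorem coe_diagGL2_inv_mul_mul_diagGL2_apply (ρ : (AdeleRing (𝓞 K) K)ˣ) (g : GL (Fin 2) (AdeleRing (𝓞 K) K)) :
    ((((diagGL2 ρ 1)⁻¹ * g * diagGL2 ρ 1 : GL (Fin 2) (AdeleRing (𝓞 K) K)) : Matrix (Fin 2) (Fin 2) (AdeleRing (𝓞 K) K)) 0 0 =
        (g : Matrix (Fin 2) (Fin 2) (AdeleRing (𝓞 K) K)) 0 0) ∧
    ((((diagGL2 ρ 1)⁻¹ * g * diagGL2 ρ 1 : GL (Fin 2) (AdeleRing (𝓞 K) K)) : Matrix (Fin 2) (Fin 2) (AdeleRing (𝓞 K) K)) 0 1 =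
        ((ρ⁻¹ : (AdeleRing (𝓞 K) K)ˣ) : AdeleRing (𝓞 K) K) * (g : Matrix (Fin 2) (Fin 2) (AdeleRing (𝓞 K) K)) 0 1) ∧
    ((((diagGL2 ρ 1)⁻¹ * g * diagGL2 ρ 1 : GL (Fin 2) (AdeleRing (𝓞 K) K)) : Matrix (Fin 2) (Fin 2) (AdeleRing (𝓞 K) K)) 1 0 =
        (ρ : AdeleRing (𝓞 K) K) * (g : Matrix (Fin 2) (Fin 2) (AdeleRing (𝓞 K) K)) 1 0) ∧
    ((((diagGL2 ρ 1)⁻¹ * g * diagGL2 ρ 1 : GL (Fin 2) (AdeleRing (𝓞 K) K)) : Matrix (Fin 2) (Fin 2) (AdeleRing (𝓞 K) K)) 1 1 =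
        (g : Matrix (Fin 2) (Fin 2) (AdeleRing (𝓞 K) K)) 1 1) := by
  rw [coe_diagGL2_inv_mul_mul_diagGL2]
  simp only [Matrix.of_apply, Matrix.cons_val', Matrix.cons_val_zero, Matrix.cons_val_one, Matrix.cons_val_fin_one,
    inv_one, Units.val_one, mul_one, one_mul]
  refine ⟨?_, trivial, ?_, trivial⟩
  · rw [mul_comm, ← mul_assoc, Units.mul_inv, one_mul]
  · rw [mul_comm]

/-- **Contraction of the flat factor**: if the entries of `g` and `g⁻¹` lie in `Z` and
`(g₀₁)_∞ = 0 = ((g⁻¹)₀₁)_∞`, then `d(z(r),1)⁻¹ g d(z(r),1) ∈ boxGL2 (starHull Z)` for every `r ≤ 1`.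
[folklore] -/
theorem diagGL2_inv_mul_mul_diagGL2_mem_boxGL2 {Z : Set (AdeleRing (𝓞 K) K)} {g : GL (Fin 2) (AdeleRing (𝓞 K) K)}
    (hZ : ∀ i j : Fin 2, (g : Matrix (Fin 2) (Fin 2) (AdeleRing (𝓞 K) K)) i j ∈ Z ∧
      (((g⁻¹ : GL (Fin 2) (AdeleRing (𝓞 K) K)) : Matrix (Fin 2) (Fin 2) (AdeleRing (𝓞 K) K)) i j ∈ Z))
    (h01 : ((g : Matrix (Fin 2) (Fin 2) (AdeleRing (𝓞 K) K)) 0 1).1 = 0)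
    (h01' : ((((g⁻¹ : GL (Fin 2) (AdeleRing (𝓞 K) K)) : Matrix (Fin 2) (Fin 2) (AdeleRing (𝓞 K) K)) 0 1).1) = 0)
    {r : ℝ≥0ˣ} (hr : (r : ℝ≥0) ≤ 1) :
    (diagGL2 (posRealIdele K r) 1)⁻¹ * g * diagGL2 (posRealIdele K r) 1 ∈ boxGL2 K (starHull K Z) := by
  set ρ : (AdeleRing (𝓞 K) K)ˣ := posRealIdele K r with hρ
  have hinv : ((diagGL2 ρ 1)⁻¹ * g * diagGL2 ρ 1)⁻¹ = (diagGL2 ρ 1)⁻¹ * g⁻¹ * diagGL2 ρ 1 := by group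
  have hρ2 : ((ρ⁻¹ : (AdeleRing (𝓞 K) K)ˣ) : AdeleRing (𝓞 K) K).2 = 1 := by
    rw [hρ, ← map_inv, posRealIdele_snd]
  obtain ⟨e00, e01, e10, e11⟩ := coe_diagGL2_inv_mul_mul_diagGL2_apply ρ g
  obtain ⟨f00, f01, f10, f11⟩ := coe_diagGL2_inv_mul_mul_diagGL2_apply ρ g⁻¹
  rw [boxGL2, mem_setOf_eq, hinv, Fin.forall_fin_two, Fin.forall_fin_two, Fin.forall_fin_two]
  refine ⟨⟨⟨?_, ?_⟩, ⟨?_, ?_⟩⟩, ⟨⟨?_, ?_⟩, ⟨?_, ?_⟩⟩⟩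
  · rw [e00]; exact subset_starHull _ (hZ 0 0).1
  · rw [f00]; exact subset_starHull _ (hZ 0 0).2
  · rw [e01]; exact mul_mem_starHull_of_fst_eq_zero (hZ 0 1).1 h01 hρ2
  · rw [f01]; exact mul_mem_starHull_of_fst_eq_zero (hZ 0 1).2 h01' hρ2
  · rw [e10]; exact posRealIdele_mul_mem_starHull (hZ 1 0).1 hr
  · rw [f10]; exact posRealIdele_mul_mem_starHull (hZ 1 0).2 hr
  · rw [e11]; exact subset_starHull _ (hZ 1 1).1
  · rw [f11]; exact subset_starHull _ (hZ 1 1).2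

end Boxes

/-! ### The mean-square regions `N_c · d(A₁, A₂) · K` and their thickenings -/

section Region

variable (K : Type) [Field K] [NumberField K]

/-- The torus pieces `{d(a₁, a₂) | a₁ ∈ A₁, a₂ ∈ A₂} ⊆ GL₂(𝔸_K)`. [folklore] -/
def torusImageGL2 (A₁ A₂ : Set (AdeleRing (𝓞 K) K)ˣ) : Set (GL (Fin 2) (AdeleRing (𝓞 K) K)) :=
  (fun p : (AdeleRing (𝓞 K) K)ˣ × (AdeleRing (𝓞 K) K)ˣ => diagGL2 p.1 p.2) '' (A₁ ×ˢ A₂)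

/-- **The mean-square regions** `N_c · d(A₁, A₂) · K ⊆ GL₂(𝔸_K)` (`N_c ⊆ N₂(𝔸_K)`,
`A₁, A₂ ⊆ 𝔸_Kˣ`, `K = K_∞ GL₂(𝒪̂_K)`), over which the mean-square method integrates `|φ|²`.
[folklore] -/
def iwasawaRegionGL2 (Nc : Set ↥(adelicUnipotent 2 K)) (A₁ A₂ : Set (AdeleRing (𝓞 K) K)ˣ) :
    Set (GL (Fin 2) (AdeleRing (𝓞 K) K)) :=
  Subtype.val '' Nc * torusImageGL2 K A₁ A₂ * (standardMaximalCompactGL 2 K : Set (GL (Fin 2) (AdeleRing (𝓞 K) K)))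

variable {K}

/-- Membership in `torusImageGL2`. [folklore] -/
theorem diagGL2_mem_torusImageGL2 {A₁ A₂ : Set (AdeleRing (𝓞 K) K)ˣ} {a₁ a₂ : (AdeleRing (𝓞 K) K)ˣ}
    (h₁ : a₁ ∈ A₁) (h₂ : a₂ ∈ A₂) : diagGL2 a₁ a₂ ∈ torusImageGL2 K A₁ A₂ :=
  ⟨(a₁, a₂), mk_mem_prod h₁ h₂, rfl⟩

/-- Membership in `iwasawaRegionGL2`. [folklore] -/
theorem mul_mul_mem_iwasawaRegionGL2 {Nc : Set ↥(adelicUnipotent 2 K)} {A₁ A₂ : Set (AdeleRing (𝓞 K) K)ˣ}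
    {u : ↥(adelicUnipotent 2 K)} (hu : u ∈ Nc) {a₁ a₂ : (AdeleRing (𝓞 K) K)ˣ} (h₁ : a₁ ∈ A₁) (h₂ : a₂ ∈ A₂)
    {k : GL (Fin 2) (AdeleRing (𝓞 K) K)} (hk : k ∈ standardMaximalCompactGL 2 K) :
    (u : GL (Fin 2) (AdeleRing (𝓞 K) K)) * diagGL2 a₁ a₂ * k ∈ iwasawaRegionGL2 K Nc A₁ A₂ :=
  Set.mul_mem_mul (Set.mul_mem_mul ⟨u, hu, rfl⟩ (diagGL2_mem_torusImageGL2 h₁ h₂)) hk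

/-- Compact data give compact torus pieces. [folklore] -/
theorem isCompact_torusImageGL2 {A₁ A₂ : Set (AdeleRing (𝓞 K) K)ˣ} (h₁ : IsCompact A₁) (h₂ : IsCompact A₂) :
    IsCompact (torusImageGL2 K A₁ A₂) :=
  (h₁.prod h₂).image continuous_diagGL2

/-- **Compact data give compact regions** (closed, `GL₂(𝔸_K)` being Hausdorff). [folklore] -/
theorem isCompact_iwasawaRegionGL2 {Nc : Set ↥(adelicUnipotent 2 K)} (hNc : IsCompact Nc)
    {A₁ A₂ : Set (AdeleRing (𝓞 K) K)ˣ} (h₁ : IsCompact A₁) (h₂ : IsCompact A₂) :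
    IsCompact (iwasawaRegionGL2 K Nc A₁ A₂) :=
  ((hNc.image continuous_subtype_val).mul (isCompact_torusImageGL2 h₁ h₂)).mul (isCompact_standardMaximalCompactGL 2 K)

/-- Translating `A₁` by an idele does not affect compactness. [folklore] -/
theorem isCompact_smul_idele {A : Set (AdeleRing (𝓞 K) K)ˣ} (hA : IsCompact A) (y : (AdeleRing (𝓞 K) K)ˣ) :
    IsCompact (y • A) :=
  hA.smul y

/-- A compact neighbourhood of `1` inside the big-cell domain `archUnitSetGL2`. [folklore] -/
theorem exists_compact_nhds_subset_archUnitSetGL2 :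
    ∃ W ∈ 𝓝 (1 : GL (Fin 2) (AdeleRing (𝓞 K) K)), IsCompact W ∧ W ⊆ archUnitSetGL2 K := by
  haveI := (topology_gl2_adele K).2.1
  obtain ⟨W, hW, hWsub, hWc⟩ :=
    local_compact_nhds ((isOpen_archUnitSetGL2 K).mem_nhds (one_mem_archUnitSetGL2 K))
  exact ⟨W, hW, hWc, hWsub⟩

/-- **Borel coordinates of a compact set, through the Iwasawa decomposition**: for compact
`E₀ ⊆ GL₂(𝔸_K)` there are compact `T₀ ⊆ (𝔸_Kˣ)²`, `N₀ ⊆ N₂(𝔸_K)` such that every `e ∈ E₀` is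
`e = d(t) n₀ k` with `t ∈ T₀`, `n₀ ∈ N₀`, `k ∈ K` (`e = b k`, `b ∈ E₀ K ∩ B`, a compact subset of
`B`). [folklore] -/
theorem exists_compact_borel_coords {E₀ : Set (GL (Fin 2) (AdeleRing (𝓞 K) K))} (hE₀ : IsCompact E₀) :
    ∃ T₀ : Set ((AdeleRing (𝓞 K) K)ˣ × (AdeleRing (𝓞 K) K)ˣ), IsCompact T₀ ∧
      ∃ N₀ : Set ↥(adelicUnipotent 2 K), IsCompact N₀ ∧
        ∀ e ∈ E₀, ∃ t ∈ T₀, ∃ n₀ ∈ N₀, ∃ k ∈ standardMaximalCompactGL 2 K,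
          e = diagGL2 t.1 t.2 * (n₀ : GL (Fin 2) (AdeleRing (𝓞 K) K)) * k := by
  haveI : T2Space (AdeleRing (𝓞 K) K) := t2Space_adeleRing K
  set B := standardParabolicGL (AdeleRing (𝓞 K) K) (id : Fin 2 → Fin 2) with hB
  have hBc : IsClosed (B : Set (GL (Fin 2) (AdeleRing (𝓞 K) K))) := isClosed_standardParabolicGL_id
  set B₀ : Set (GL (Fin 2) (AdeleRing (𝓞 K) K)) :=
    E₀ * (standardMaximalCompactGL 2 K : Set (GL (Fin 2) (AdeleRing (𝓞 K) K))) ∩ B with hB₀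
  have hB₀c : IsCompact B₀ := (hE₀.mul (isCompact_standardMaximalCompactGL 2 K)).inter_right hBc
  set B₀' : Set ↥B := Subtype.val ⁻¹' B₀ with hB₀'
  have hB₀'c : IsCompact B₀' := hBc.isClosedEmbedding_subtypeVal.isCompact_preimage hB₀c
  refine ⟨borelDiagGL2 '' B₀', hB₀'c.image continuous_borelDiagGL2, borelUnipGL2 '' B₀',
    hB₀'c.image continuous_borelUnipGL2, fun e he => ?_⟩
  obtain ⟨b, hb, k, hk, hebk⟩ := exists_borel_mul_maximalCompact_eq K e
  have hbB₀ : b ∈ B₀ := by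
    refine ⟨Set.mem_mul.2 ⟨e, he, k⁻¹, inv_mem hk, ?_⟩, hb⟩
    rw [hebk, mul_inv_cancel_right]
  set b' : ↥B := ⟨b, hb⟩ with hb'
  have hb'mem : b' ∈ B₀' := hbB₀
  refine ⟨borelDiagGL2 b', mem_image_of_mem _ hb'mem, borelUnipGL2 b', mem_image_of_mem _ hb'mem, k, hk, ?_⟩
  rw [diagGL2_mul_borelUnipGL2]
  exact hebk

/-- **Conjugates of a compact unipotent set by the contracting torus stay in a compact set**: for
compact `T₀ ⊆ (𝔸_Kˣ)²`, `N₀ ⊆ N₂(𝔸_K)` there is a compact `N₁ ⊆ N₂(𝔸_K)` containing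
`d(z(r) t₁, t₂) n₀ d(z(r) t₁, t₂)⁻¹` for all `r ≤ 1`, `t ∈ T₀`, `n₀ ∈ N₀` (its entry is
`z(r) · (t₁ x₀ t₂⁻¹)`, inside the archimedean star hull of a compact set). [folklore] -/
theorem exists_compact_torusConj_mem {T₀ : Set ((AdeleRing (𝓞 K) K)ˣ × (AdeleRing (𝓞 K) K)ˣ)} (hT₀ : IsCompact T₀)
    {N₀ : Set ↥(adelicUnipotent 2 K)} (hN₀ : IsCompact N₀) :
    ∃ N₁ : Set ↥(adelicUnipotent 2 K), IsCompact N₁ ∧ ∀ r : ℝ≥0ˣ, (r : ℝ≥0) ≤ 1 →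
      ∀ t ∈ T₀, ∀ n₀ ∈ N₀, torusConjGL2 (posRealIdele K r * t.1, t.2)⁻¹ n₀ ∈ N₁ := by
  set f : ((AdeleRing (𝓞 K) K)ˣ × (AdeleRing (𝓞 K) K)ˣ) × ↥(adelicUnipotent 2 K) → AdeleRing (𝓞 K) K :=
    fun p => (p.1.1 : AdeleRing (𝓞 K) K) *
      ((p.2 : GL (Fin 2) (AdeleRing (𝓞 K) K)) : Matrix (Fin 2) (Fin 2) (AdeleRing (𝓞 K) K)) 0 1 *
        ((p.1.2⁻¹ : (AdeleRing (𝓞 K) K)ˣ) : AdeleRing (𝓞 K) K) with hf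
  have hfc : Continuous f :=
    ((Units.continuous_val.comp (continuous_fst.comp continuous_fst)).mul
      (continuous_entry_zero_one.comp continuous_snd)).mul
      (Units.continuous_val.comp (continuous_inv.comp (continuous_snd.comp continuous_fst)))
  set Z₁ := f '' (T₀ ×ˢ N₀) with hZ₁
  have hZ₁c : IsCompact Z₁ := (hT₀.prod hN₀).image hfc
  refine ⟨unipotentGL2 '' starHull K Z₁, (isCompact_starHull hZ₁c).image continuous_unipotentGL2,
    fun r hr t ht n₀ hn₀ => ?_⟩
  refine ⟨_, posRealIdele_mul_mem_starHull (Z := Z₁) ⟨(t, n₀), mk_mem_prod ht hn₀, rfl⟩ hr, ?_⟩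
  unfold torusConjGL2
  congr 1
  simp only [Prod.fst_inv, Prod.snd_inv, inv_inv, hf, Units.val_mul]
  ring

/-- **Thickening the mean-square regions.** Let `N_c ⊆ N₂(𝔸_K)` and `Y₁, C₂ ⊆ 𝔸_Kˣ` be
compact. There are a neighbourhood `B'` of `1` in `GL₂(𝔸_K)` and compact `N'' ⊆ N₂(𝔸_K)`,
`Y₁', C₂' ⊆ 𝔸_Kˣ` such that for every `r ≤ 1`,
`B' · (N_c · d(z(r) Y₁, C₂) · K) ⊆ N'' · d(z(r) Y₁', C₂') · K`:
the left thickening by `B'` of the region dilated by the archimedean scalar `z(r)` is a region of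
the same shape with the same dilation. Proof: `b' u = u w` with `w = u⁻¹ b' u` uniformly close to `1`
(`exists_nhds_one_forall_conj_mem`); `w = n(x_w) w♭` with `(w♭₀₁)_∞ = 0` (big cell at the
archimedean places, `bigCellFlat`); `w♭ d(z(r),1) = d(z(r),1) v` with `v` in a fixed compact set
(`diagGL2_inv_mul_mul_diagGL2_mem_boxGL2`: conjugation by `d(z(r),1)⁻¹` contracts the lower entry and
does not see the vanishing upper archimedean entry); `v d(y, a₂) k = d(t) n₀ k'` in Borel
coordinates (`exists_compact_borel_coords`); and `d(z(r) t₁, t₂) n₀ = n₁ d(z(r) t₁, t₂)` with `n₁` in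
a fixed compact set (`exists_compact_torusConj_mem`). [folklore] -/
theorem exists_thickening_iwasawaRegionGL2_subset {Nc : Set ↥(adelicUnipotent 2 K)} (hNc : IsCompact Nc)
    {Y₁ C₂ : Set (AdeleRing (𝓞 K) K)ˣ} (hY₁ : IsCompact Y₁) (hC₂ : IsCompact C₂) :
    ∃ B' ∈ 𝓝 (1 : GL (Fin 2) (AdeleRing (𝓞 K) K)), ∃ N'' : Set ↥(adelicUnipotent 2 K), IsCompact N'' ∧
      ∃ Y₁' C₂' : Set (AdeleRing (𝓞 K) K)ˣ, IsCompact Y₁' ∧ IsCompact C₂' ∧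
        ∀ r : ℝ≥0ˣ, (r : ℝ≥0) ≤ 1 →
          B' * iwasawaRegionGL2 K Nc (posRealIdele K r • Y₁) C₂ ⊆
            iwasawaRegionGL2 K N'' (posRealIdele K r • Y₁') C₂' := by
  haveI : T2Space (AdeleRing (𝓞 K) K) := t2Space_adeleRing K
  -- Step 1: a compact neighbourhood `W` of `1` in the big cell, and `B'` with `u⁻¹ B' u ⊆ W` on `N_c`
  obtain ⟨W, hW1, hWc, hWsub⟩ := exists_compact_nhds_subset_archUnitSetGL2 (K := K)
  obtain ⟨B', hB'1, hB'⟩ := exists_nhds_one_forall_conj_mem (hNc.image continuous_subtype_val) hW1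
  -- Step 2: the shifts and flat factors of `W`
  set XW : Set (AdeleRing (𝓞 K) K) := bigCellShift K '' W with hXW
  have hXWc : IsCompact XW := hWc.image_of_continuousOn (continuousOn_bigCellShift.mono hWsub)
  set Wf : Set (GL (Fin 2) (AdeleRing (𝓞 K) K)) := bigCellFlat K '' W with hWf
  have hWfc : IsCompact Wf := hWc.image_of_continuousOn (continuousOn_bigCellFlat.mono hWsub)
  -- Step 3: the entries of the flat factors and their inverses, and the contracted box `V`
  set ent : Fin 2 → Fin 2 → GL (Fin 2) (AdeleRing (𝓞 K) K) → AdeleRing (𝓞 K) K :=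
    fun i j g => (g : Matrix (Fin 2) (Fin 2) (AdeleRing (𝓞 K) K)) i j with hent
  set ent' : Fin 2 → Fin 2 → GL (Fin 2) (AdeleRing (𝓞 K) K) → AdeleRing (𝓞 K) K :=
    fun i j g => (((g⁻¹ : GL (Fin 2) (AdeleRing (𝓞 K) K)) : Matrix (Fin 2) (Fin 2) (AdeleRing (𝓞 K) K)) i j) with hent'
  have hentc : ∀ i j, Continuous (ent i j) := fun i j => Units.continuous_val.matrix_elem i j
  have hent'c : ∀ i j, Continuous (ent' i j) := fun i j => (Units.continuous_val.comp continuous_inv).matrix_elem i j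
  set Z₀ : Set (AdeleRing (𝓞 K) K) := ⋃ i : Fin 2, ⋃ j : Fin 2, (ent i j '' Wf ∪ ent' i j '' Wf) with hZ₀
  have hZ₀c : IsCompact Z₀ :=
    isCompact_iUnion fun i => isCompact_iUnion fun j => (hWfc.image (hentc i j)).union (hWfc.image (hent'c i j))
  have hZ₀mem : ∀ g ∈ Wf, ∀ i j : Fin 2, (g : Matrix (Fin 2) (Fin 2) (AdeleRing (𝓞 K) K)) i j ∈ Z₀ ∧
      (((g⁻¹ : GL (Fin 2) (AdeleRing (𝓞 K) K)) : Matrix (Fin 2) (Fin 2) (AdeleRing (𝓞 K) K)) i j ∈ Z₀) := by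
    intro g hg i j
    exact ⟨mem_iUnion.2 ⟨i, mem_iUnion.2 ⟨j, Or.inl ⟨g, hg, rfl⟩⟩⟩, mem_iUnion.2 ⟨i, mem_iUnion.2 ⟨j, Or.inr ⟨g, hg, rfl⟩⟩⟩⟩
  set V : Set (GL (Fin 2) (AdeleRing (𝓞 K) K)) := boxGL2 K (starHull K Z₀) with hV
  have hVc : IsCompact V := isCompact_boxGL2 (isCompact_starHull hZ₀c)
  -- Step 4: Borel coordinates of the fixed compact `E₀ = V · d(Y₁, C₂) · K`
  set E₀ : Set (GL (Fin 2) (AdeleRing (𝓞 K) K)) :=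
    V * torusImageGL2 K Y₁ C₂ * (standardMaximalCompactGL 2 K : Set (GL (Fin 2) (AdeleRing (𝓞 K) K))) with hE₀
  have hE₀c : IsCompact E₀ := (hVc.mul (isCompact_torusImageGL2 hY₁ hC₂)).mul (isCompact_standardMaximalCompactGL 2 K)
  obtain ⟨T₀, hT₀c, N₀, hN₀c, hcoords⟩ := exists_compact_borel_coords hE₀c
  -- Step 5: the compact set of torus conjugates
  obtain ⟨N₁, hN₁c, hN₁⟩ := exists_compact_torusConj_mem hT₀c hN₀c
  -- the data
  refine ⟨B', hB'1, Nc * (unipotentGL2 '' XW) * N₁, (hNc.mul (hXWc.image continuous_unipotentGL2)).mul hN₁c,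
    Prod.fst '' T₀, Prod.snd '' T₀, hT₀c.image continuous_fst, hT₀c.image continuous_snd, fun r hr => ?_⟩
  -- Step 6: the containment
  rintro g ⟨b', hb', _, ⟨_, ⟨_, ⟨u, hu, rfl⟩, _, ⟨⟨a₁, a₂⟩, ⟨ha₁, ha₂⟩, rfl⟩, rfl⟩, k, hk, rfl⟩, rfl⟩
  obtain ⟨y, hy, rfl⟩ := mem_smul_set.1 ha₁
  set ρ : (AdeleRing (𝓞 K) K)ˣ := posRealIdele K r with hρ
  -- `w = u⁻¹ b' u ∈ W`
  set w : GL (Fin 2) (AdeleRing (𝓞 K) K) := (u : GL (Fin 2) (AdeleRing (𝓞 K) K))⁻¹ * b' * u with hw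
  have hwW : w ∈ W := hB' _ ⟨u, hu, rfl⟩ b' hb'
  have hwU : w ∈ archUnitSetGL2 K := hWsub hwW
  -- `w = n(x) w♭`
  set x := bigCellShift K w with hx
  set wf := bigCellFlat K w with hwf
  have hxX : x ∈ XW := ⟨w, hwW, rfl⟩
  have hwfW : wf ∈ Wf := ⟨w, hwW, rfl⟩
  have hwsplit : ((unipotentGL2 x : ↥(adelicUnipotent 2 K)) : GL (Fin 2) (AdeleRing (𝓞 K) K)) * wf = w :=
    unipotentGL2_bigCellShift_mul_bigCellFlat w
  -- `v = d(ρ,1)⁻¹ w♭ d(ρ,1) ∈ V`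
  set v : GL (Fin 2) (AdeleRing (𝓞 K) K) := (diagGL2 ρ 1)⁻¹ * wf * diagGL2 ρ 1 with hv
  have hvV : v ∈ V :=
    diagGL2_inv_mul_mul_diagGL2_mem_boxGL2 (hZ₀mem wf hwfW) (bigCellFlat_apply_zero_one_fst hwU)
      (inv_apply_zero_one_fst_eq_zero (bigCellFlat_apply_zero_one_fst hwU)) hr
  -- `e = v d(y, a₂) k ∈ E₀`, `e = d(t) n₀ k₁`
  set e : GL (Fin 2) (AdeleRing (𝓞 K) K) := v * diagGL2 y a₂ * k with he
  have heE₀ : e ∈ E₀ := Set.mul_mem_mul (Set.mul_mem_mul hvV (diagGL2_mem_torusImageGL2 hy ha₂)) hk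
  obtain ⟨t, ht, n₀, hn₀, k₁, hk₁, hek⟩ := hcoords e heE₀
  -- the torus conjugate `n₁`
  set n₁ : ↥(adelicUnipotent 2 K) := torusConjGL2 (ρ * t.1, t.2)⁻¹ n₀ with hn₁
  have hn₁N₁ : n₁ ∈ N₁ := hN₁ r hr t ht n₀ hn₀
  have hn₁eq : ((n₁ : ↥(adelicUnipotent 2 K)) : GL (Fin 2) (AdeleRing (𝓞 K) K)) * diagGL2 (ρ * t.1) t.2 =
      diagGL2 (ρ * t.1) t.2 * (n₀ : GL (Fin 2) (AdeleRing (𝓞 K) K)) := by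
    rw [hn₁, coe_torusConjGL2, Prod.fst_inv, Prod.snd_inv, ← diagGL2_inv, inv_inv]
    group
  -- the witness
  have hgoal : b' * ((u : GL (Fin 2) (AdeleRing (𝓞 K) K)) * diagGL2 (ρ • y) a₂ * k) =
      ((u * unipotentGL2 x * n₁ : ↥(adelicUnipotent 2 K)) : GL (Fin 2) (AdeleRing (𝓞 K) K)) *
        diagGL2 (ρ * t.1) t.2 * k₁ := by
    have h1 : b' * (u : GL (Fin 2) (AdeleRing (𝓞 K) K)) = u * w := by rw [hw]; group
    have h2 : diagGL2 (ρ • y) a₂ = diagGL2 ρ 1 * diagGL2 y a₂ := by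
      rw [smul_eq_mul, ← diagGL2_mul, one_mul]
    have h3 : diagGL2 (ρ * t.1) t.2 = diagGL2 ρ 1 * diagGL2 t.1 t.2 := by
      rw [← diagGL2_mul, one_mul]
    have h4 : wf * diagGL2 ρ 1 = diagGL2 ρ 1 * v := by rw [hv]; group
    calc b' * ((u : GL (Fin 2) (AdeleRing (𝓞 K) K)) * diagGL2 (ρ • y) a₂ * k)
        = (b' * (u : GL (Fin 2) (AdeleRing (𝓞 K) K))) * diagGL2 (ρ • y) a₂ * k := by group
      _ = (u : GL (Fin 2) (AdeleRing (𝓞 K) K)) * (((unipotentGL2 x : ↥(adelicUnipotent 2 K)) :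
            GL (Fin 2) (AdeleRing (𝓞 K) K)) * wf) * (diagGL2 ρ 1 * diagGL2 y a₂) * k := by rw [h1, hwsplit, h2]
      _ = (u : GL (Fin 2) (AdeleRing (𝓞 K) K)) * ((unipotentGL2 x : ↥(adelicUnipotent 2 K)) :
            GL (Fin 2) (AdeleRing (𝓞 K) K)) * (wf * diagGL2 ρ 1) * diagGL2 y a₂ * k := by group
      _ = (u : GL (Fin 2) (AdeleRing (𝓞 K) K)) * ((unipotentGL2 x : ↥(adelicUnipotent 2 K)) :
            GL (Fin 2) (AdeleRing (𝓞 K) K)) * diagGL2 ρ 1 * (v * diagGL2 y a₂ * k) := by rw [h4]; group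
      _ = (u : GL (Fin 2) (AdeleRing (𝓞 K) K)) * ((unipotentGL2 x : ↥(adelicUnipotent 2 K)) :
            GL (Fin 2) (AdeleRing (𝓞 K) K)) * diagGL2 ρ 1 * (diagGL2 t.1 t.2 * (n₀ : GL (Fin 2) (AdeleRing (𝓞 K) K)) * k₁) := by
          rw [← he, hek]
      _ = (u : GL (Fin 2) (AdeleRing (𝓞 K) K)) * ((unipotentGL2 x : ↥(adelicUnipotent 2 K)) :
            GL (Fin 2) (AdeleRing (𝓞 K) K)) * (diagGL2 (ρ * t.1) t.2 * (n₀ : GL (Fin 2) (AdeleRing (𝓞 K) K))) * k₁ := by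
          rw [h3]; group
      _ = (u : GL (Fin 2) (AdeleRing (𝓞 K) K)) * ((unipotentGL2 x : ↥(adelicUnipotent 2 K)) :
            GL (Fin 2) (AdeleRing (𝓞 K) K)) * (((n₁ : ↥(adelicUnipotent 2 K)) : GL (Fin 2) (AdeleRing (𝓞 K) K)) *
            diagGL2 (ρ * t.1) t.2) * k₁ := by rw [hn₁eq]
      _ = ((u * unipotentGL2 x * n₁ : ↥(adelicUnipotent 2 K)) : GL (Fin 2) (AdeleRing (𝓞 K) K)) *
            diagGL2 (ρ * t.1) t.2 * k₁ := by
          rw [Subgroup.coe_mul, Subgroup.coe_mul]; group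
  change b' * ((u : GL (Fin 2) (AdeleRing (𝓞 K) K)) * diagGL2 (ρ • y) a₂ * k) ∈ _
  rw [hgoal]
  have hxmem : unipotentGL2 x ∈ unipotentGL2 '' XW := mem_image_of_mem _ hxX
  have ht1 : t.1 ∈ Prod.fst '' T₀ := mem_image_of_mem _ ht
  have ht2 : t.2 ∈ Prod.snd '' T₀ := mem_image_of_mem _ ht
  exact mul_mul_mem_iwasawaRegionGL2 (Set.mul_mem_mul (Set.mul_mem_mul hu hxmem) hn₁N₁)
    (smul_mem_smul_set ht1) ht2 hk₁

end Region

end Literature.NumberTheory.Automorphic
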